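import Mathlib
import Summits.NavierStokesRegularity.NavierStokesRegularity.Theorems.SubOnsagerCeilingOrthantTailCeiling.Negative.OrthantTailCeilingFalseOfSideBranchCriticalEscapeEstimate
import HarnessLib

/-!
# Route SubOnsagerCeiling — CEILING ⇒ NO ONSAGER-CRITICAL ESCAPE for the side-branch table `α_SB`
# (helper file for item stmt-NavierStokesRegularity-25507 `OrthantTailCeiling`; `--supports`; def-free)

The POSITIVE form of the negative lemma
`Theorems/SubOnsagerCeilingOrthantTailCeiling/Negative/OrthantTailCeilingFalseOfSideBranchCriticalEscapeEstimate.lean`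
(this seat, p823602), stated once for every future escape construction, whatever its quantifier shape
(one exhibited solution, a sequence of viscosities, an a priori estimate, …):

* `ceilingAt_sideBranch_noCriticalEscape` — if the per-table tail ceiling `CeilingAt 10 ε₀ α_SB` holds
  then for every rate constant `c > 0` there is a depth `K₀` such that for all `K ≥ K₀`, every one-shell
  datum `X₀` of positive energy `E₀` and every horizon `T > 0` there is a viscosity threshold `ν̄ > 0`
  below which EVERY regular `ν`-viscous solution of `α_SB` on any window `[0,s]`, `s ≤ T`, keeps
  `Σ_{k ≤ K} Σ_i ½X_{i,k}(s)² > (1 − c·(1+ε₀)^{-K})·E₀`: the block `0..K` never loses the Onsager-critical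
  amount `c·b^{-K}·E₀`.

So ANY regular solution (or family) losing `c·b^{-K}·E₀` from the block `0..K` at a depth `K ≥ K₀(c)` and a
viscosity below `ν̄` refutes `CeilingAt 10 ε₀ α_SB`, hence `OrthantTailCeiling`
(`orthantTailCeiling_iff_ceilingAt`) and `ForwardTailCeiling` (`forwardTailCeiling_imp_ceilingAt_sideBranchTable`).
Proof = the one of p823602 (tail `K+1..K'` under the ceiling `≤ C E₀ b^{-2θ(K+1)} ≤ (c/4)E₀b^{-K}` by
`sideBranch_ceilingTail_le_quarter`; loss of the deeper block `0..K'` `≤ Φ₁ b^{-(θ-1/2)K'} + 2ν_{K'}E_max s`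
by `sideBranch_deepBlockLoss_le_of_shellCeiling`; `2θ > 1`), run on a GIVEN solution instead of the
engine's.

HONEST FRAMING: elementary bookkeeping on a Tao-type MODEL lattice ODE (route SubOnsagerCeiling, rung
TL-M2Break); an implication from an OPEN (numerically refuted) statement; nothing here bears on
Navier–Stokes regularity; no crux is settled here. [cite: Tao2016AveragedNS, §4 (4.5), (4.8)]
-/

noncomputable section

-- the sub-problem namespace `NavierStokesRegularity.NavierStokesRegularity` is the tree's layout (D-0017)
set_option linter.dupNamespace false

namespace Summit.NavierStokesRegularity.NavierStokesRegularity.Theorems.SubOnsagerCeiling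

open Set Filter
open scoped Topology
open Literature.Analysis.FluidPDE.TaoCascade
open Summit.NavierStokesRegularity.NavierStokesRegularity.Theses.SubOnsagerCeiling

/-- **CEILING ⇒ NO ONSAGER-CRITICAL ESCAPE (positive form, all quantifier shapes at once).** Under
`CeilingAt 10 ε₀ sideBranchTable`: for every `c > 0` there is `K₀` such that for all `K ≥ K₀`, all
one-shell data `X₀` with `E₀ > 0` and all horizons `T > 0` there is `ν̄ > 0` such that every regular
solution of the `ν`-viscous `α_SB` lattice (`0 < ν ≤ ν̄`) on a window `[0,s]`, `0 < s ≤ T`, from `X₀`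
(one-shell datum, no shells below `0`, Tao's weight bound (4.5), continuous modes, exact viscous
equation within `[0,s]`) satisfies `(1 − c·(1+ε₀)^{-K})·E₀ < Σ_{k ≤ K} Σ_i ½X_{i,k}(s)²`.
MODEL lattice only. [this file] -/
theorem ceilingAt_sideBranch_noCriticalEscape {ε₀ : ℝ} (hε : 0 < ε₀)
    (hCeil : CeilingAt 10 ε₀ sideBranchTable) {c : ℝ} (hc : 0 < c) :
    ∃ K₀ : ℕ, ∀ K : ℕ, K₀ ≤ K → ∀ X₀ : Fin 4 → ℝ, 0 < (∑ i : Fin 4, (1 / 2 : ℝ) * X₀ i ^ 2) →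
      ∀ T : ℝ, 0 < T → ∃ ν₁ : ℝ, 0 < ν₁ ∧ ∀ ν : ℝ, 0 < ν → ν ≤ ν₁ → ∀ s : ℝ, 0 < s → s ≤ T →
        ∀ X : Fin 4 → ℤ → ℝ → ℝ,
          (∀ (i : Fin 4) (k : ℤ), X i k 0 = if k = 0 then X₀ i else 0) →
          (∀ (i : Fin 4) (k : ℤ), k < 0 → ∀ t : ℝ, X i k t = 0) →
          (∃ M : ℝ, ∀ (t : ℝ) (i : Fin 4) (k : ℤ), (1 + (1 + ε₀) ^ ((10 : ℝ) * k)) * |X i k t| ≤ M) →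
          (∀ (i : Fin 4) (k : ℤ), Continuous (X i k)) →
          (∀ (i : Fin 4) (k : ℤ), ∀ t ∈ Set.Icc (0 : ℝ) s, HasDerivWithinAt (X i k)
            (quadTerm ε₀ sideBranchTable X i k t - ν * (1 + ε₀) ^ ((2 : ℝ) * k) * X i k t)
            (Set.Icc (0 : ℝ) s) t) →
          (1 - c * (1 + ε₀) ^ (-(K : ℝ))) * (∑ i : Fin 4, (1 / 2 : ℝ) * X₀ i ^ 2) <
            ∑ k ∈ Finset.range (K + 1), ∑ i : Fin 4, (1 / 2 : ℝ) * X i (k : ℤ) s ^ 2 := by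
  obtain ⟨θ, hθ, C, hC, hceil⟩ := hCeil sideBranchTable_inTableClass sideBranchTable_orthant
  have hb : (0 : ℝ) < 1 + ε₀ := by linarith
  have hb1 : (1 : ℝ) < 1 + ε₀ := by linarith
  -- the depth `K₀`: `C · r^K < c/4` for `K ≥ K₀`, `r = b^{-(2θ-1)} < 1`
  set r : ℝ := (1 + ε₀) ^ (-(2 * θ - 1)) with hrdef
  have hr0 : 0 ≤ r := Real.rpow_nonneg hb.le _
  have hr1 : r < 1 := Real.rpow_lt_one_of_one_lt_of_neg hb1 (by linarith)
  have hc4 : 0 < c / 4 := by positivity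
  have htendr : Tendsto (fun K : ℕ => C * r ^ K) atTop (𝓝 (C * 0)) :=
    (tendsto_pow_atTop_nhds_zero_of_lt_one hr0 hr1).const_mul C
  rw [mul_zero] at htendr
  obtain ⟨K₀, hK₀⟩ := Filter.eventually_atTop.1 (htendr.eventually (gt_mem_nhds hc4))
  refine ⟨K₀, fun K hKK₀ X₀ hE₀ T hT => ?_⟩
  have hCK : C * r ^ K < c / 4 := hK₀ K hKK₀
  set E₀ : ℝ := ∑ i : Fin 4, (1 / 2 : ℝ) * X₀ i ^ 2 with hE₀def
  have hE₀0 : 0 ≤ E₀ := hE₀.le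
  -- the quarter of the forbidden escape
  set w : ℝ := c / 4 * E₀ * (1 + ε₀) ^ (-(K : ℝ)) with hwdef
  have hbK : 0 < (1 + ε₀) ^ (-(K : ℝ)) := Real.rpow_pos_of_pos hb _
  have hw : 0 < w := by positivity
  -- the deeper bond `K'` with `Φ₁ q^{K'} < w`, `q = b^{-(θ-1/2)} < 1`
  set A : ℝ := Real.sqrt (2 * C * E₀) with hAdef
  set Φ₁ : ℝ := (5 + T / 2 + 25 * Real.exp 1 / 2 + Real.exp 1) * A ^ 2 +
    5 * Real.exp 1 / 2 * A ^ 3 + 5 * T / 2 * A with hΦ₁def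
  set q : ℝ := (1 + ε₀) ^ (-(θ - 1 / 2)) with hqdef
  have hq0 : 0 ≤ q := Real.rpow_nonneg hb.le _
  have hq1 : q < 1 := Real.rpow_lt_one_of_one_lt_of_neg hb1 (by linarith)
  have htend : Tendsto (fun K' : ℕ => Φ₁ * q ^ K') atTop (𝓝 (Φ₁ * 0)) :=
    (tendsto_pow_atTop_nhds_zero_of_lt_one hq0 hq1).const_mul Φ₁
  rw [mul_zero] at htend
  obtain ⟨K', hK'small, hK'ge⟩ := ((htend.eventually (gt_mem_nhds hw)).and
    (eventually_ge_atTop (K + 1))).exists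
  have hqK' : (1 + ε₀) ^ (-((θ - 1 / 2) * (K' : ℝ))) = q ^ K' := by
    rw [show -((θ - 1 / 2) * (K' : ℝ)) = (-(θ - 1 / 2)) * (K' : ℝ) by ring,
      Real.rpow_mul_natCast hb.le]
  -- the viscosity threshold
  set Emax : ℝ := C * E₀ * ((K' : ℝ) + 1) with hEmaxdef
  have hEmax0 : 0 ≤ Emax := by positivity
  set D : ℝ := 2 * (1 + ε₀) ^ ((2 : ℝ) * (K' : ℝ)) * Emax * T + 1 with hDdef
  have hD0 : 0 < D := by positivity
  set ν₁ : ℝ := min 1 (min (1 / ((1 + ε₀) ^ ((2 : ℝ) * ((K' : ℝ) + 1)) * T)) (w / D)) with hν₁def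
  have hν₁ : 0 < ν₁ := lt_min one_pos (lt_min (by positivity) (by positivity))
  refine ⟨ν₁, hν₁, fun ν hν hνle s hs hsT X hinit hlow hbd hcont hder => ?_⟩
  have hν11 : ν ≤ 1 := hνle.trans (min_le_left _ _)
  have hν12 : ν ≤ 1 / ((1 + ε₀) ^ ((2 : ℝ) * ((K' : ℝ) + 1)) * T) :=
    hνle.trans ((min_le_right _ _).trans (min_le_left _ _))
  have hν13 : ν ≤ w / D := hνle.trans ((min_le_right _ _).trans (min_le_right _ _))
  -- cone invariance (item 25508, proved): non-negative on shells `≥ 1`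
  have hpos := orthantInvariance_proof ε₀ ν hε hν sideBranchTable sideBranchTable_orthant X₀ s hs X
    hinit hlow hbd hcont hder
  -- the ceiling along the solution: tail form and per-shell form
  have htail := fun (u : ℝ) (hu : u ∈ Icc (0 : ℝ) s) (n N : ℕ) (hnN : n ≤ N) =>
    hceil ν hν X₀ s hs X hinit hlow hbd hcont hder hpos n N hnN u hu
  have hshell : ∀ u ∈ Icc (0 : ℝ) s, ∀ k : ℕ,
      ∑ i : Fin 4, (1 / 2 : ℝ) * X i (k : ℤ) u ^ 2 ≤
        C * (∑ i : Fin 4, (1 / 2 : ℝ) * X₀ i ^ 2) * (1 + ε₀) ^ (-(2 * θ * (k : ℝ))) := by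
    intro u hu k
    have h := htail u hu k k le_rfl
    rw [Finset.Icc_self, Finset.sum_singleton] at h
    exact h
  -- the loss of the deep block `0..K'` (metering of record)
  have hss : s ∈ Icc (0 : ℝ) s := ⟨hs.le, le_rfl⟩
  have hK'1 : 1 ≤ K' := le_trans (by omega) hK'ge
  have hP0 : 0 < (1 + ε₀) ^ ((2 : ℝ) * ((K' : ℝ) + 1)) * T := by positivity
  have hνt : ν * (1 + ε₀) ^ ((2 : ℝ) * ((K' : ℝ) + 1)) * s ≤ 1 := by
    calc ν * (1 + ε₀) ^ ((2 : ℝ) * ((K' : ℝ) + 1)) * s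
        ≤ ν * (1 + ε₀) ^ ((2 : ℝ) * ((K' : ℝ) + 1)) * T := by gcongr
      _ ≤ 1 / ((1 + ε₀) ^ ((2 : ℝ) * ((K' : ℝ) + 1)) * T) *
            (1 + ε₀) ^ ((2 : ℝ) * ((K' : ℝ) + 1)) * T := by gcongr
      _ = 1 := by field_simp
  have hdeep := sideBranch_deepBlockLoss_le_of_shellCeiling hε hν.le hν11 hθ hC hinit hlow hcont hder
    hs hsT hshell K' hK'1 hνt
  rw [← hE₀def, ← hAdef, ← hΦ₁def, hqK', ← hEmaxdef] at hdeep
  -- dissipation of the deep block: `2 ν_{K'} E_max s ≤ w`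
  have hdiss : 2 * (ν * (1 + ε₀) ^ ((2 : ℝ) * (K' : ℝ))) * Emax * s ≤ w := by
    have h1 : 2 * (ν * (1 + ε₀) ^ ((2 : ℝ) * (K' : ℝ))) * Emax * s ≤
        2 * ((w / D) * (1 + ε₀) ^ ((2 : ℝ) * (K' : ℝ))) * Emax * T := by gcongr
    have h2 : 2 * ((w / D) * (1 + ε₀) ^ ((2 : ℝ) * (K' : ℝ))) * Emax * T =
        w * ((2 * (1 + ε₀) ^ ((2 : ℝ) * (K' : ℝ)) * Emax * T) / D) := by
      field_simp
    have h3 : (2 * (1 + ε₀) ^ ((2 : ℝ) * (K' : ℝ)) * Emax * T) / D ≤ 1 := by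
      rw [div_le_one hD0, hDdef]
      linarith
    have h4 : w * ((2 * (1 + ε₀) ^ ((2 : ℝ) * (K' : ℝ)) * Emax * T) / D) ≤ w :=
      mul_le_of_le_one_right hw.le h3
    linarith
  -- the tail between `K+1` and `K'` under the ceiling: `≤ C E₀ b^{-2θ(K+1)} ≤ w`
  have hmid : ∑ k ∈ Finset.Icc (K + 1) K', ∑ i : Fin 4, (1 / 2 : ℝ) * X i (k : ℤ) s ^ 2 ≤ w :=
    (htail s hss (K + 1) K' hK'ge).trans
      (sideBranch_ceilingTail_le_quarter hε (by linarith) hC hE₀0 K hCK.le)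
  -- split the deep block and compare
  rw [sideBranch_sum_range_split _ hK'ge] at hdeep
  have hclaim : (1 - c * (1 + ε₀) ^ (-(K : ℝ))) * E₀ = E₀ - 4 * w := by rw [hwdef]; ring
  rw [hclaim]
  linarith

end Summit.NavierStokesRegularity.NavierStokesRegularity.Theorems.SubOnsagerCeiling

end
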